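import Summits.Ventures.PercRepro2.CaseOneGadgetUWOBPendant

/-!
# The Q-threshold forms propagate down a pendant edge: `(ii-Q)(v) ⟹ (ii-Q)(a₃)`, `(i-Q)(v) ⟹ (i-Q)(a₃)`
(blind cell PercRepro2, p1 g21; S5 §2.1 (K9): the Q-side of the pendant lemma K8)

The pendant lemma K8 (`zSplitII_of_leaf_at`, `zSplitI_of_leaf_at`) reduces `(ii)` / `(i)` at a leaf `a₃`
of `v` to `(ii)`, `(ii-Q)` / `(i)`, `(i-Q)` at `v`, because the PD-threshold pair at `a₃` is the mixture
`(1 − t) · (Q-pair) + t · (PD-pair at v)`. The Q-threshold pair `(P(Q, o ∈ U), P(Q))` does not depend on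
the statement vertex at all, so at a general pair the forms simply scale: **`iiExprT_of_leaf_at`**,
**`iExprT_of_leaf_at`** — `iiExprT(a₃; c₀, c₁) = p(e₀) · iiExprT(v; c₀, c₁)` (the same computation as
`iiExpr_eq_of_leaf_at` with the pair left symbolic) — whence **`zSplitIIQ_of_leaf_at`**,
**`zSplitIQ_of_leaf_at`**: `(ii-Q)` and `(i-Q)` at `v` give `(ii-Q)` and `(i-Q)` at every leaf `a₃` of `v`,
for every weight of the leaf edge. Corollaries: the pendant marked star (`zSplitIIQ_of_pendantStar`,
`zSplitIQ_of_pendantStar`) and the pendant uwob gadget (`zSplitIIQ_of_pendantGadgetUWOB`,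
`zSplitIQ_of_pendantGadgetUWOB`) are closed on `(ii-Q)` / `(i-Q)` as well — so both pendant classes are
closed on every row of the class table, and a further leaf at `a₃` inherits everything again. Own code;
standard axioms. -/

namespace Summit.Ventures.PercRepro2

namespace CaseOne

section Scale
variable {V : Type*} {E : Type*} [Fintype E] [DecidableEq E] {R : Type*} [CommRing R]
variable {ends : E → Sym2 V} {v a₃ : V} {e₀ : E}

/-- **`iiExprT(a₃; c₀, c₁) = p(e₀) · iiExprT(v; c₀, c₁)`** when `a₃` is a leaf at `v` (`o, a₁, a₂, b ≠ a₃`),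
for every threshold pair. -/
theorem iiExprT_of_leaf_at (p : E → R) (hl : IsLeafAt ends v a₃ e₀) (o a₁ a₂ b : V)
    (ho : o ≠ a₃) (h1 : a₁ ≠ a₃) (h2 : a₂ ≠ a₃) (hb : b ≠ a₃) (c₀ c₁ : R) :
    iiExprT p ends o a₁ a₂ a₃ b c₀ c₁ = p e₀ * iiExprT p ends o a₁ a₂ v b c₀ c₁ := by
  unfold iiExprT zFunT
  simp only [indicator_leaf_at hl h1]
  have hv : v ≠ a₃ := hl.ne
  have e1 : expect p (fun ω => (connEvent ends a₂ b).indicator (1 : Config E → R) ω *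
      ((openEdge e₀).indicator 1 ω * (connEvent ends a₁ v).indicator 1 ω *
        (c₁ * (connEvent ends a₂ o).indicator 1 ω - c₀)) *
      ((connEvent ends a₁ a₂)ᶜ).indicator 1 ω) =
      p e₀ * expect p (fun ω => (connEvent ends a₂ b).indicator (1 : Config E → R) ω *
        ((connEvent ends a₁ v).indicator 1 ω * (c₁ * (connEvent ends a₂ o).indicator 1 ω - c₀)) *
        ((connEvent ends a₁ a₂)ᶜ).indicator 1 ω) := by
    have : (fun ω => (connEvent ends a₂ b).indicator (1 : Config E → R) ω *
        ((openEdge e₀).indicator 1 ω * (connEvent ends a₁ v).indicator 1 ω *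
          (c₁ * (connEvent ends a₂ o).indicator 1 ω - c₀)) *
        ((connEvent ends a₁ a₂)ᶜ).indicator 1 ω) =
        fun ω => ((connEvent ends a₂ b).indicator (1 : Config E → R) ω *
          ((connEvent ends a₁ v).indicator 1 ω * (c₁ * (connEvent ends a₂ o).indicator 1 ω - c₀)) *
          ((connEvent ends a₁ a₂)ᶜ).indicator 1 ω) * (openEdge e₀).indicator 1 ω := by
      funext ω; ring
    rw [this, expect_mul_openEdge_of_ignore p e₀ _ (fun ω c => by
      simp only [Set.indicator_compl, Pi.one_apply, Pi.sub_apply]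
      rw [connEvent_indicator_update_of_leaf hl ω c h2 hb,
        connEvent_indicator_update_of_leaf hl ω c h1 hv,
        connEvent_indicator_update_of_leaf hl ω c h2 ho,
        connEvent_indicator_update_of_leaf hl ω c h1 h2])]
  have e2 : expect p (fun ω => (openEdge e₀).indicator (1 : Config E → R) ω *
      (connEvent ends a₁ v).indicator 1 ω * (c₁ * (connEvent ends a₂ o).indicator 1 ω - c₀) *
      ((connEvent ends a₁ a₂)ᶜ).indicator 1 ω) =
      p e₀ * expect p (fun ω => (connEvent ends a₁ v).indicator (1 : Config E → R) ω *
        (c₁ * (connEvent ends a₂ o).indicator 1 ω - c₀) * ((connEvent ends a₁ a₂)ᶜ).indicator 1 ω) := by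
    have : (fun ω => (openEdge e₀).indicator (1 : Config E → R) ω *
        (connEvent ends a₁ v).indicator 1 ω * (c₁ * (connEvent ends a₂ o).indicator 1 ω - c₀) *
        ((connEvent ends a₁ a₂)ᶜ).indicator 1 ω) =
        fun ω => ((connEvent ends a₁ v).indicator (1 : Config E → R) ω *
          (c₁ * (connEvent ends a₂ o).indicator 1 ω - c₀) *
          ((connEvent ends a₁ a₂)ᶜ).indicator 1 ω) * (openEdge e₀).indicator 1 ω := by
      funext ω; ring
    rw [this, expect_mul_openEdge_of_ignore p e₀ _ (fun ω c => by
      simp only [Set.indicator_compl, Pi.one_apply, Pi.sub_apply]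
      rw [connEvent_indicator_update_of_leaf hl ω c h1 hv,
        connEvent_indicator_update_of_leaf hl ω c h2 ho,
        connEvent_indicator_update_of_leaf hl ω c h1 h2])]
  rw [e1, e2]
  ring

/-- **`iExprT(a₃; c₀, c₁) = p(e₀) · iExprT(v; c₀, c₁)`** when `a₃` is a leaf at `v` (`o, a₁, a₂, b ≠ a₃`),
for every threshold pair. -/
theorem iExprT_of_leaf_at (p : E → R) (hl : IsLeafAt ends v a₃ e₀) (o a₁ a₂ b : V)
    (ho : o ≠ a₃) (h1 : a₁ ≠ a₃) (h2 : a₂ ≠ a₃) (hb : b ≠ a₃) (c₀ c₁ : R) :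
    iExprT p ends o a₁ a₂ a₃ b c₀ c₁ = p e₀ * iExprT p ends o a₁ a₂ v b c₀ c₁ := by
  unfold iExprT zFunT
  simp only [indicator_leaf_at hl h1]
  have hv : v ≠ a₃ := hl.ne
  have e1 : expect p (fun ω => (connEvent ends a₁ b).indicator (1 : Config E → R) ω *
      ((openEdge e₀).indicator 1 ω * (connEvent ends a₁ v).indicator 1 ω *
        (c₁ * (connEvent ends a₂ o).indicator 1 ω - c₀)) *
      ((connEvent ends a₁ a₂)ᶜ).indicator 1 ω) =
      p e₀ * expect p (fun ω => (connEvent ends a₁ b).indicator (1 : Config E → R) ω *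
        ((connEvent ends a₁ v).indicator 1 ω * (c₁ * (connEvent ends a₂ o).indicator 1 ω - c₀)) *
        ((connEvent ends a₁ a₂)ᶜ).indicator 1 ω) := by
    have : (fun ω => (connEvent ends a₁ b).indicator (1 : Config E → R) ω *
        ((openEdge e₀).indicator 1 ω * (connEvent ends a₁ v).indicator 1 ω *
          (c₁ * (connEvent ends a₂ o).indicator 1 ω - c₀)) *
        ((connEvent ends a₁ a₂)ᶜ).indicator 1 ω) =
        fun ω => ((connEvent ends a₁ b).indicator (1 : Config E → R) ω *
          ((connEvent ends a₁ v).indicator 1 ω * (c₁ * (connEvent ends a₂ o).indicator 1 ω - c₀)) *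
          ((connEvent ends a₁ a₂)ᶜ).indicator 1 ω) * (openEdge e₀).indicator 1 ω := by
      funext ω; ring
    rw [this, expect_mul_openEdge_of_ignore p e₀ _ (fun ω c => by
      simp only [Set.indicator_compl, Pi.one_apply, Pi.sub_apply]
      rw [connEvent_indicator_update_of_leaf hl ω c h1 hb,
        connEvent_indicator_update_of_leaf hl ω c h1 hv,
        connEvent_indicator_update_of_leaf hl ω c h2 ho,
        connEvent_indicator_update_of_leaf hl ω c h1 h2])]
  have e2 : expect p (fun ω => (openEdge e₀).indicator (1 : Config E → R) ω *
      (connEvent ends a₁ v).indicator 1 ω * (c₁ * (connEvent ends a₂ o).indicator 1 ω - c₀) *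
      ((connEvent ends a₁ a₂)ᶜ).indicator 1 ω) =
      p e₀ * expect p (fun ω => (connEvent ends a₁ v).indicator (1 : Config E → R) ω *
        (c₁ * (connEvent ends a₂ o).indicator 1 ω - c₀) * ((connEvent ends a₁ a₂)ᶜ).indicator 1 ω) := by
    have : (fun ω => (openEdge e₀).indicator (1 : Config E → R) ω *
        (connEvent ends a₁ v).indicator 1 ω * (c₁ * (connEvent ends a₂ o).indicator 1 ω - c₀) *
        ((connEvent ends a₁ a₂)ᶜ).indicator 1 ω) =
        fun ω => ((connEvent ends a₁ v).indicator (1 : Config E → R) ω *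
          (c₁ * (connEvent ends a₂ o).indicator 1 ω - c₀) *
          ((connEvent ends a₁ a₂)ᶜ).indicator 1 ω) * (openEdge e₀).indicator 1 ω := by
      funext ω; ring
    rw [this, expect_mul_openEdge_of_ignore p e₀ _ (fun ω c => by
      simp only [Set.indicator_compl, Pi.one_apply, Pi.sub_apply]
      rw [connEvent_indicator_update_of_leaf hl ω c h1 hv,
        connEvent_indicator_update_of_leaf hl ω c h2 ho,
        connEvent_indicator_update_of_leaf hl ω c h1 h2])]
  rw [e1, e2]
  ring

end Scale

section QPendant
variable {V : Type*} {E : Type*} [Fintype E] [DecidableEq E] {R : Type*} [CommRing R]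
  [LinearOrder R] [IsStrictOrderedRing R]
variable {ends : E → Sym2 V} {v a₃ : V} {e₀ : E}

/-- **The Q-side of the pendant lemma**: `(ii-Q)(v) ⟹ (ii-Q)(a₃)` when `a₃` is a leaf at `v`
(`o, a₁, a₂, b ≠ a₃`), for every weight of the leaf edge. -/
theorem zSplitIIQ_of_leaf_at (p : E → R) (hp : IsProbVec p) (hl : IsLeafAt ends v a₃ e₀)
    (o a₁ a₂ b : V) (ho : o ≠ a₃) (h1 : a₁ ≠ a₃) (h2 : a₂ ≠ a₃) (hb : b ≠ a₃)
    (hQ : ZSplitIIQ p ends o a₁ a₂ v b) : ZSplitIIQ p ends o a₁ a₂ a₃ b := by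
  unfold ZSplitIIQ at hQ ⊢
  rw [iiExprT_of_leaf_at p hl o a₁ a₂ b ho h1 h2 hb]
  exact mul_nonneg (hp.nonneg e₀) hQ

/-- **The Q-side of the `(i)` pendant lemma**: `(i-Q)(v) ⟹ (i-Q)(a₃)` when `a₃` is a leaf at `v`. -/
theorem zSplitIQ_of_leaf_at (p : E → R) (hp : IsProbVec p) (hl : IsLeafAt ends v a₃ e₀)
    (o a₁ a₂ b : V) (ho : o ≠ a₃) (h1 : a₁ ≠ a₃) (h2 : a₂ ≠ a₃) (hb : b ≠ a₃)
    (hQ : ZSplitIQ p ends o a₁ a₂ v b) : ZSplitIQ p ends o a₁ a₂ a₃ b := by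
  unfold ZSplitIQ at hQ ⊢
  rw [iExprT_of_leaf_at p hl o a₁ a₂ b ho h1 h2 hb]
  exact mul_nonneg (hp.nonneg e₀) hQ

end QPendant

section Classes
variable {V : Type*} {E : Type*} [Fintype E] [DecidableEq E] [Fintype V] [DecidableEq V]
  {R : Type*} [Field R] [LinearOrder R] [IsStrictOrderedRing R]
variable {ends : E → Sym2 V} {o a₁ a₂ b u w a₃ : V} {e₀ : E}

/-- **`(ii-Q)` for `a₃` pendant at a marked-star vertex** (the `G − e₀` form). -/
theorem zSplitIIQ_of_leaf_markedStar (p : E → R) (hp : IsProbVec p) (hl : IsLeafAt ends u a₃ e₀)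
    (ho : o ≠ a₃) (h1 : a₁ ≠ a₃) (h2 : a₂ ≠ a₃) (hb : b ≠ a₃) {e₁ e₂ eo eb : {e : E // e ≠ e₀}}
    (h : IsMarkedStarAt (restrictEnds ends e₀) o a₁ a₂ b u e₁ e₂ eo eb) :
    ZSplitIIQ p ends o a₁ a₂ a₃ b :=
  zSplitIIQ_of_leaf_at p hp hl o a₁ a₂ b ho h1 h2 hb
    (zSplitIIQ_of_restrict p hl ho h1 h2 hl.ne hb
      (zSplitIIQ_of_markedStar (restrictW p e₀) (IsProbVec.restrictW hp e₀) h))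

/-- **`(i-Q)` for `a₃` pendant at a marked-star vertex** (the `G − e₀` form). -/
theorem zSplitIQ_of_leaf_markedStar (p : E → R) (hp : IsProbVec p) (hl : IsLeafAt ends u a₃ e₀)
    (ho : o ≠ a₃) (h1 : a₁ ≠ a₃) (h2 : a₂ ≠ a₃) (hb : b ≠ a₃) {e₁ e₂ eo eb : {e : E // e ≠ e₀}}
    (h : IsMarkedStarAt (restrictEnds ends e₀) o a₁ a₂ b u e₁ e₂ eo eb) :
    ZSplitIQ p ends o a₁ a₂ a₃ b :=
  zSplitIQ_of_leaf_at p hp hl o a₁ a₂ b ho h1 h2 hb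
    (zSplitIQ_of_restrict p hl ho h1 h2 hl.ne hb
      (zSplitIQ_of_markedStar (restrictW p e₀) (IsProbVec.restrictW hp e₀) h))

variable {e₁ e₂ eo eb : E}

/-- **`(ii-Q)` for the pendant star in `G`.** -/
theorem zSplitIIQ_of_pendantStar (p : E → R) (hp : IsProbVec p)
    (h : IsPendantStarAt ends o a₁ a₂ b u a₃ e₀ e₁ e₂ eo eb) : ZSplitIIQ p ends o a₁ a₂ a₃ b :=
  zSplitIIQ_of_leaf_markedStar p hp h.leaf h.ne_o' h.ne_a1' h.ne_a2' h.ne_b' h.markedStar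

/-- **`(i-Q)` for the pendant star in `G`.** -/
theorem zSplitIQ_of_pendantStar (p : E → R) (hp : IsProbVec p)
    (h : IsPendantStarAt ends o a₁ a₂ b u a₃ e₀ e₁ e₂ eo eb) : ZSplitIQ p ends o a₁ a₂ a₃ b :=
  zSplitIQ_of_leaf_markedStar p hp h.leaf h.ne_o' h.ne_a1' h.ne_a2' h.ne_b' h.markedStar

/-- **`(ii-Q)` for `a₃` pendant at a uwob-gadget vertex** (the `G − e₀` form). -/
theorem zSplitIIQ_of_leaf_gadgetUWOB (p : E → R) (hp : IsProbVec p) (hl : IsLeafAt ends u a₃ e₀)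
    (ho : o ≠ a₃) (h1 : a₁ ≠ a₃) (h2 : a₂ ≠ a₃) (hb : b ≠ a₃)
    {euw euo eub ewa1 ewa2 : {e : E // e ≠ e₀}}
    (h : IsGadgetUWOB (restrictEnds ends e₀) o a₁ a₂ b u w euw euo eub ewa1 ewa2) :
    ZSplitIIQ p ends o a₁ a₂ a₃ b :=
  zSplitIIQ_of_leaf_at p hp hl o a₁ a₂ b ho h1 h2 hb
    (zSplitIIQ_of_restrict p hl ho h1 h2 hl.ne hb
      (zSplitIIQ_of_gadgetUWOB (restrictW p e₀) (IsProbVec.restrictW hp e₀) h))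

/-- **`(i-Q)` for `a₃` pendant at a uwob-gadget vertex** (the `G − e₀` form). -/
theorem zSplitIQ_of_leaf_gadgetUWOB (p : E → R) (hp : IsProbVec p) (hl : IsLeafAt ends u a₃ e₀)
    (ho : o ≠ a₃) (h1 : a₁ ≠ a₃) (h2 : a₂ ≠ a₃) (hb : b ≠ a₃)
    {euw euo eub ewa1 ewa2 : {e : E // e ≠ e₀}}
    (h : IsGadgetUWOB (restrictEnds ends e₀) o a₁ a₂ b u w euw euo eub ewa1 ewa2) :
    ZSplitIQ p ends o a₁ a₂ a₃ b :=
  zSplitIQ_of_leaf_at p hp hl o a₁ a₂ b ho h1 h2 hb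
    (zSplitIQ_of_restrict p hl ho h1 h2 hl.ne hb
      (zSplitIQ_of_gadgetUWOB (restrictW p e₀) (IsProbVec.restrictW hp e₀) h))

variable {euw euo eub ewa1 ewa2 : E}

/-- **`(ii-Q)` for the pendant gadget in `G`.** -/
theorem zSplitIIQ_of_pendantGadgetUWOB (p : E → R) (hp : IsProbVec p)
    (h : IsPendantGadgetUWOBAt ends o a₁ a₂ b u w a₃ e₀ euw euo eub ewa1 ewa2) :
    ZSplitIIQ p ends o a₁ a₂ a₃ b :=
  zSplitIIQ_of_leaf_gadgetUWOB p hp h.leaf h.ne_o' h.ne_a1' h.ne_a2' h.ne_b' h.gadgetUWOB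

/-- **`(i-Q)` for the pendant gadget in `G`.** -/
theorem zSplitIQ_of_pendantGadgetUWOB (p : E → R) (hp : IsProbVec p)
    (h : IsPendantGadgetUWOBAt ends o a₁ a₂ b u w a₃ e₀ euw euo eub ewa1 ewa2) :
    ZSplitIQ p ends o a₁ a₂ a₃ b :=
  zSplitIQ_of_leaf_gadgetUWOB p hp h.leaf h.ne_o' h.ne_a1' h.ne_a2' h.ne_b' h.gadgetUWOB

end Classes

end CaseOne

end Summit.Ventures.PercRepro2
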